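import Literature.NumberTheory.GaloisRepresentations.ContinuousCorestriction
import HarnessLib

/-!
# The finite coinduced representation `Maps(G ⧸ N, X)` and the Shapiro lift of continuous
# crossed homomorphisms, in degree one

Generic continuous group cohomology (no number theory), companion of
`ContinuousCorestriction.lean`.  Let `G` be a topological group, `X : TopRep R G` a topological
representation (arbitrary topological coefficients, e.g. a `p`-adic `T`) and `N ≤ G` a subgroup.
This file provides, with complete proofs:

* `coindFin X N : TopRep R G` — the representation of `G` on the functions `G ⧸ N → X`
  (product topology) by `(g ⋆ φ)(y) = g • φ(g⁻¹ • y)`: for `N` of finite index this is the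
  (co)induced module `Ind_N^G Res_N X ≅ X ⊗ ℤ[G/N]` with the diagonal action
  (Serre, *Local Fields*, VII.§5–§6; Neukirch–Schmidt–Wingberg, I.§6 "induced modules");
* `shapiroCocycle` — the **Shapiro lift** of a continuous crossed homomorphism `f : N → X` to a
  continuous crossed homomorphism `F : G → Maps(G ⧸ N, X)`,
  `F(g)(y) = s(y) • f(s(y)⁻¹ g s(g⁻¹ • y))` for a system `s` of left coset representatives —
  written with the SAME Schreier elements as the tree's transfer `transferFun`, so that the sum
  over the fibre is the transfer ON THE NOSE: `Σ_y F(g)(y) = (cor f)(g)` (`sum_shapiroCocycle_apply`);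
* `evalOne` — evaluation of a crossed homomorphism `G → Maps(G ⧸ N, X)` at the unit coset,
  restricted to `N` (the inverse Shapiro map on cocycles), with `evalOne (shapiroCocycle f) = f`
  when `s(N) = 1` (`evalOne_shapiroCocycle`);
* **Shapiro injectivity in degree one** (`oneCocycleClass_eq_zero_of_evalOne`): a continuous
  crossed homomorphism `F : G → Maps(G ⧸ N, X)` whose evaluation at the unit coset is a coboundary
  on `N` is a coboundary (explicit: `φ(y) = s(y) • v − F(s(y))(y)`);
* for `N` normal, the right translations `rTransHom X N c` (`c ∈ G ⧸ N`) are endomorphisms of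
  `coindFin X N`, and under `evalOne` right translation by `γN` is the action `conjMap` of `γ` on
  `H¹(N, X)` (`conjMap_evalOne_eq`): `γ · [F(·)(N)] = [F(·)(γN)]`.

This is the degree-one, explicit-cocycle form of Shapiro's lemma for continuous cohomology
(Mathlib has Shapiro only for discrete group cohomology, `groupCohomology.coindIso`); it is the
cochain-level input of Iwasawa-theoretic arguments that pass between `lim←_n H¹(G_n, T)` and
`Λ`-adic crossed homomorphisms on `G` (e.g. Kato, Astérisque 295, §13.8 / (14.14.1)).

## References

* J.-P. Serre, *Local Fields* (1979), VII.§5 (the action of `G/H`), VII.§6 (induced modules,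
  Shapiro). [SerreLocalFields1979]
* J. Neukirch, A. Schmidt, K. Wingberg, *Cohomology of Number Fields*, 2nd ed. (2008), I.§5
  (cor via coset representatives), I.§6 Prop. (1.6.4) (Shapiro's lemma). [NeukirchSchmidtWingberg2008]
* Tree: `GaloisRepresentations/ContinuousCorestriction.lean` (`transferFun`, `cores`, `conjMap`),
  `GaloisRepresentations/ContinuousH1.lean` (`contOneCocycles`, `oneCocycleClass`),
  `EllipticCurves/PeriodIndexCorestriction.lean` (`schreierElt`).

## Design notes

* Universes as in `ContinuousCorestriction`: `G : Type v`, `X : TopRep.{v} R G`, so that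
  `G ⧸ N → X` lives in `Type v` again.
* No finiteness of `G ⧸ N` is needed for `coindFin`, the lift or Shapiro injectivity; it enters
  only the fibre sum (`[Fintype (G ⧸ N)]`).  Openness of `N` (discreteness of `G ⧸ N`) is needed for
  the continuity of the lift, exactly as for `continuous_transferFun`.
* No `instance` beyond Mathlib's `Pi` instances; no notation.
-/

noncomputable section

open CategoryTheory

universe u v

namespace Literature.NumberTheory.GaloisRepresentations

open Literature.NumberTheory.EllipticCurves (schreierElt schreierElt_mem schreierElt_coe
  rep_mul_schreierElt schreierElt_mul subgroupConj subgroupConj_apply_coe)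

variable {R : Type u} [Ring R] [TopologicalSpace R]
variable {G : Type v} [Group G] [TopologicalSpace G] [IsTopologicalGroup G]

/-! ## The representation `Maps(G ⧸ N, X)` -/

section Coind

variable (X : TopRep.{v} R G) (N : Subgroup G)

/-- The operator of `g ∈ G` on functions `G ⧸ N → X`: `(g ⋆ φ)(y) = g • φ(g⁻¹ • y)`, a continuous
linear map for the product topology. [cite: SerreLocalFields1979, VII.§6] -/
def coindFinOp (g : G) : (G ⧸ N → X) →L[R] (G ⧸ N → X) where
  toFun φ := fun y => X.ρ g (φ (g⁻¹ • y))
  map_add' φ ψ := by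
    ext y
    simp only [Pi.add_apply, map_add]
  map_smul' r φ := by
    ext y
    simp only [Pi.smul_apply, map_smul, RingHom.id_apply]
  cont := continuous_pi fun y => (X.ρ g).continuous.comp (continuous_apply (g⁻¹ • y))

omit [TopologicalSpace G] [IsTopologicalGroup G] in
/-- Unfolding `coindFinOp`. [cite: NeukirchSchmidtWingberg2008, I.§6 (induced modules)] -/
@[simp]
theorem coindFinOp_apply (g : G) (φ : G ⧸ N → X) (y : G ⧸ N) :
    coindFinOp X N g φ y = X.ρ g (φ (g⁻¹ • y)) :=
  rfl

/-- The continuous representation `g ↦ (φ ↦ g ⋆ φ)` of `G` on `G ⧸ N → X`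
(`1 ⋆ φ = φ`, `(g h) ⋆ φ = g ⋆ (h ⋆ φ)`). [cite: SerreLocalFields1979, VII.§6] -/
def coindFinRep : ContRepresentation R G (G ⧸ N → X) :=
  .ofMonoidHom
    { toFun := coindFinOp X N
      map_one' := by
        ext φ y
        change X.ρ 1 (φ (1⁻¹ • y)) = φ y
        rw [inv_one, one_smul, map_one]
        rfl
      map_mul' := fun g h => by
        ext φ y
        change X.ρ (g * h) (φ ((g * h)⁻¹ • y)) = X.ρ g (X.ρ h (φ (h⁻¹ • (g⁻¹ • y))))
        rw [mul_inv_rev, mul_smul, ρ_mul_apply] }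

omit [TopologicalSpace G] [IsTopologicalGroup G] in
/-- Unfolding `coindFinRep`. [cite: NeukirchSchmidtWingberg2008, I.§6 (induced modules)] -/
@[simp]
theorem coindFinRep_apply_apply (g : G) (φ : G ⧸ N → X) (y : G ⧸ N) :
    coindFinRep X N g φ y = X.ρ g (φ (g⁻¹ • y)) :=
  rfl

/-- **The finite coinduced representation** `Maps(G ⧸ N, X)` of `G`, `(g ⋆ φ)(y) = g • φ(g⁻¹ • y)`,
with the product topology (for `N` of finite index: `Ind_N^G Res_N X ≅ X ⊗ ℤ[G/N]` with the diagonal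
action). [cite: SerreLocalFields1979, VII.§6] [cite: NeukirchSchmidtWingberg2008, I.§6] -/
def coindFin : TopRep.{v} R G :=
  TopRep.of (coindFinRep X N)

omit [TopologicalSpace G] [IsTopologicalGroup G] in
/-- The action of `coindFin X N` on elements: `(g ⋆ φ)(y) = g • φ(g⁻¹ • y)`. [cite: NeukirchSchmidtWingberg2008, I.§6 (induced modules)] -/
@[simp]
theorem coindFin_ρ_apply (g : G) (φ : coindFin X N) (y : G ⧸ N) :
    (coindFin X N).ρ g φ y = X.ρ g (φ (g⁻¹ • y)) :=
  rfl

omit [TopologicalSpace G] [IsTopologicalGroup G] in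
/-- Pointwise addition in `Maps(G ⧸ N, X)`. [cite: NeukirchSchmidtWingberg2008, I.§6 (induced modules)] -/
theorem coindFin_add_apply (φ ψ : coindFin X N) (y : G ⧸ N) : (φ + ψ) y = φ y + ψ y :=
  rfl

omit [TopologicalSpace G] [IsTopologicalGroup G] in
/-- Pointwise subtraction in `Maps(G ⧸ N, X)`. [cite: NeukirchSchmidtWingberg2008, I.§6 (induced modules)] -/
theorem coindFin_sub_apply (φ ψ : coindFin X N) (y : G ⧸ N) : (φ - ψ) y = φ y - ψ y :=
  rfl

omit [TopologicalSpace G] [IsTopologicalGroup G] in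
/-- Pointwise negation in `Maps(G ⧸ N, X)`. [cite: NeukirchSchmidtWingberg2008, I.§6 (induced modules)] -/
theorem coindFin_neg_apply (φ : coindFin X N) (y : G ⧸ N) : (-φ) y = -(φ y) :=
  rfl

omit [TopologicalSpace G] [IsTopologicalGroup G] in
/-- For `h ∈ N`, `h • (1 · N) = 1 · N` in `G ⧸ N`. [cite: NeukirchSchmidtWingberg2008, I.§5 (coset representatives)] -/
theorem smul_mk_one_of_mem {h : G} (hh : h ∈ N) :
    h • ((1 : G) : G ⧸ N) = ((1 : G) : G ⧸ N) := by
  rw [MulAction.Quotient.smul_coe, smul_eq_mul, mul_one, QuotientGroup.eq, mul_one]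
  exact N.inv_mem hh

omit [TopologicalSpace G] [IsTopologicalGroup G] in
/-- For `h ∈ N`, `h⁻¹ • (1 · N) = 1 · N` in `G ⧸ N`. [cite: NeukirchSchmidtWingberg2008, I.§5 (coset representatives)] -/
theorem inv_smul_mk_one_of_mem {h : G} (hh : h ∈ N) :
    h⁻¹ • ((1 : G) : G ⧸ N) = ((1 : G) : G ⧸ N) :=
  smul_mk_one_of_mem N (N.inv_mem hh)

omit [TopologicalSpace G] [IsTopologicalGroup G] in
/-- A representative `s(y)` acts on the unit coset by `s(y) • (1 · N) = y`. [cite: NeukirchSchmidtWingberg2008, I.§5 (coset representatives)] -/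
theorem rep_smul_mk_one {s : G ⧸ N → G} (hs : ∀ x : G ⧸ N, (s x : G ⧸ N) = x) (y : G ⧸ N) :
    s y • ((1 : G) : G ⧸ N) = y := by
  rw [MulAction.Quotient.smul_coe, smul_eq_mul, mul_one, hs]

omit [TopologicalSpace G] [IsTopologicalGroup G] in
/-- `s(y)⁻¹ • y = 1 · N`. [cite: NeukirchSchmidtWingberg2008, I.§5 (coset representatives)] -/
theorem rep_inv_smul {s : G ⧸ N → G} (hs : ∀ x : G ⧸ N, (s x : G ⧸ N) = x) (y : G ⧸ N) :
    (s y)⁻¹ • y = ((1 : G) : G ⧸ N) := by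
  rw [inv_smul_eq_iff, rep_smul_mk_one N hs]

end Coind

/-! ## The Shapiro lift of a crossed homomorphism on `N` -/

section Lift

variable (X : TopRep.{v} R G) (N : Subgroup G) {s : G ⧸ N → G}

/-- The **Shapiro lift** of a continuous crossed homomorphism `f : N → X` as a bare function
`G → (G ⧸ N → X)`: `F(g)(y) = s(y) • f(s(y)⁻¹ g s(g⁻¹ • y))`, the Schreier element being the tree's
`schreierElt N hs g (g⁻¹ • y)`. [cite: NeukirchSchmidtWingberg2008, I.§5–§6] -/
def shapiroFun (hs : ∀ x : G ⧸ N, (s x : G ⧸ N) = x) (f : contOneCocycles (subgroupRep X N))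
    (g : G) : G ⧸ N → X :=
  fun y => X.ρ (s y) (f.1 (schreierElt N hs g (g⁻¹ • y)))

omit [IsTopologicalGroup G] in
/-- Unfolding `shapiroFun`. [cite: NeukirchSchmidtWingberg2008, I.§6 Prop. (1.6.4)] -/
theorem shapiroFun_apply (hs : ∀ x : G ⧸ N, (s x : G ⧸ N) = x)
    (f : contOneCocycles (subgroupRep X N)) (g : G) (y : G ⧸ N) :
    shapiroFun X N hs f g y = X.ρ (s y) (f.1 (schreierElt N hs g (g⁻¹ • y))) :=
  rfl

omit [IsTopologicalGroup G] in
/-- Values of the lift on the translated coset: `F(g)(g • x) = s(g • x) • f(schreierElt g x)` — the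
summand of the transfer `transferFun`. [cite: NeukirchSchmidtWingberg2008, I.§5 (coset representatives)] -/
theorem shapiroFun_apply_smul (hs : ∀ x : G ⧸ N, (s x : G ⧸ N) = x)
    (f : contOneCocycles (subgroupRep X N)) (g : G) (x : G ⧸ N) :
    shapiroFun X N hs f g (g • x) = X.ρ (s (g • x)) (f.1 (schreierElt N hs g x)) := by
  rw [shapiroFun_apply, inv_smul_smul]

omit [IsTopologicalGroup G] in
/-- **The lift is a crossed homomorphism** for `coindFin X N`:
`F(g₁ g₂)(y) = F(g₁)(y) + g₁ • F(g₂)(g₁⁻¹ • y)` (cocycle rule of the Schreier elements).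
[cite: NeukirchSchmidtWingberg2008, I.§5] -/
theorem shapiroFun_mul (hs : ∀ x : G ⧸ N, (s x : G ⧸ N) = x)
    (f : contOneCocycles (subgroupRep X N)) (g₁ g₂ : G) (y : G ⧸ N) :
    shapiroFun X N hs f (g₁ * g₂) y =
      shapiroFun X N hs f g₁ y + X.ρ g₁ (shapiroFun X N hs f g₂ (g₁⁻¹ • y)) := by
  -- write `y = g₁ • x`
  obtain ⟨x, rfl⟩ : ∃ x, y = g₁ • x := ⟨g₁⁻¹ • y, (smul_inv_smul g₁ y).symm⟩
  rw [inv_smul_smul, shapiroFun_apply_smul]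
  -- and `x = g₂ • z`
  obtain ⟨z, rfl⟩ : ∃ z, x = g₂ • z := ⟨g₂⁻¹ • x, (smul_inv_smul g₂ x).symm⟩
  rw [shapiroFun_apply_smul, shapiroFun_apply, ← mul_smul, inv_smul_smul, schreierElt_mul,
    subgroup_cocycle_mul, map_add, ← ρ_mul_apply, mul_smul, rep_mul_schreierElt, ρ_mul_apply]

/-- **The lift is continuous** for the product topology when `N` is open (`G ⧸ N` discrete; same
argument as `continuous_transferFun`). [cite: NeukirchSchmidtWingberg2008, I.§6 Prop. (1.6.4)] -/
theorem continuous_shapiroFun (hN : IsOpen (N : Set G)) (hs : ∀ x : G ⧸ N, (s x : G ⧸ N) = x)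
    (f : contOneCocycles (subgroupRep X N)) : Continuous (shapiroFun X N hs f) := by
  haveI : DiscreteTopology (G ⧸ N) := QuotientGroup.discreteTopology hN
  refine continuous_pi fun y => ?_
  have h1 : Continuous fun g : G => g⁻¹ • y := continuous_inv.smul continuous_const
  have h2 : Continuous fun g : G => s (g⁻¹ • y) := continuous_of_discreteTopology.comp h1
  have h3 : Continuous fun g : G => s (g • (g⁻¹ • y)) :=
    continuous_of_discreteTopology.comp (continuous_id.smul h1)
  have hsch : Continuous fun g : G => schreierElt N hs g (g⁻¹ • y) :=
    Continuous.subtype_mk ((h3.inv.mul continuous_id).mul h2) fun g =>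
      schreierElt_mem N hs g (g⁻¹ • y)
  exact (X.ρ (s y)).continuous.comp (f.1.continuous.comp hsch)

/-- **The Shapiro lift on cocycles**: `f ↦ F`, a continuous crossed homomorphism
`G → Maps(G ⧸ N, X)` for the representation `coindFin X N`.
[cite: NeukirchSchmidtWingberg2008, I.§6 Prop. (1.6.4)] -/
def shapiroCocycle (hN : IsOpen (N : Set G)) (hs : ∀ x : G ⧸ N, (s x : G ⧸ N) = x)
    (f : contOneCocycles (subgroupRep X N)) : contOneCocycles (coindFin X N) :=
  ⟨⟨shapiroFun X N hs f, continuous_shapiroFun X N hN hs f⟩, fun g₁ g₂ => by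
    refine funext fun y => ?_
    exact shapiroFun_mul X N hs f g₁ g₂ y⟩

/-- Values of `shapiroCocycle`. [cite: NeukirchSchmidtWingberg2008, I.§6 Prop. (1.6.4)] -/
@[simp]
theorem shapiroCocycle_apply (hN : IsOpen (N : Set G)) (hs : ∀ x : G ⧸ N, (s x : G ⧸ N) = x)
    (f : contOneCocycles (subgroupRep X N)) (g : G) (y : G ⧸ N) :
    (shapiroCocycle X N hN hs f).1 g y = X.ρ (s y) (f.1 (schreierElt N hs g (g⁻¹ • y))) :=
  rfl

/-- **The fibre sum of the Shapiro lift is the transfer, on the nose**: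
`Σ_{y ∈ G/N} F(g)(y) = Σ_{x} s(g • x) • f(schreierElt g x) = (cor_s f)(g)` (reindex `y = g • x`).
[cite: NeukirchSchmidtWingberg2008, I.§5–§6] -/
theorem sum_shapiroCocycle_apply [Fintype (G ⧸ N)] (hN : IsOpen (N : Set G))
    (hs : ∀ x : G ⧸ N, (s x : G ⧸ N) = x) (f : contOneCocycles (subgroupRep X N)) (g : G) :
    ∑ y : G ⧸ N, (shapiroCocycle X N hN hs f).1 g y = transferFun X N hs f g := by
  rw [transferFun_apply, ← Equiv.sum_comp (MulAction.toPerm g)]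
  refine Finset.sum_congr rfl fun x _ => ?_
  rw [MulAction.toPerm_apply, shapiroCocycle_apply, inv_smul_smul]

end Lift

/-! ## Evaluation at the unit coset: the inverse Shapiro map on cocycles -/

section EvalOne

variable (X : TopRep.{v} R G) (N : Subgroup G)

/-- **Evaluation at the unit coset**, restricted to `N`: a continuous crossed homomorphism
`F : G → Maps(G ⧸ N, X)` gives the continuous crossed homomorphism `h ↦ F(h)(1·N)` on `N`
(`N` fixes the unit coset). This is the cocycle-level inverse of the Shapiro lift.
[cite: NeukirchSchmidtWingberg2008, I.§6 Prop. (1.6.4)] -/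
def evalOne (F : contOneCocycles (coindFin X N)) : contOneCocycles (subgroupRep X N) :=
  ⟨⟨fun h => F.1 (h : G) ((1 : G) : G ⧸ N),
      (continuous_apply _).comp (F.1.continuous.comp continuous_subtype_val)⟩, fun a b => by
    change F.1 ((a : G) * b) ((1 : G) : G ⧸ N) =
      F.1 a ((1 : G) : G ⧸ N) + X.ρ (a : G) (F.1 b ((1 : G) : G ⧸ N))
    rw [F.2, coindFin_add_apply, coindFin_ρ_apply, inv_smul_mk_one_of_mem N a.2]⟩

omit [IsTopologicalGroup G] in
/-- Values of `evalOne`. [cite: NeukirchSchmidtWingberg2008, I.§6 Prop. (1.6.4)] -/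
@[simp]
theorem evalOne_apply (F : contOneCocycles (coindFin X N)) (h : N) :
    (evalOne X N F).1 h = F.1 (h : G) ((1 : G) : G ⧸ N) :=
  rfl

omit [IsTopologicalGroup G] in
/-- `evalOne` is additive. [cite: NeukirchSchmidtWingberg2008, I.§6 Prop. (1.6.4)] -/
theorem evalOne_add (F F' : contOneCocycles (coindFin X N)) :
    evalOne X N (F + F') = evalOne X N F + evalOne X N F' := by
  apply Subtype.ext; ext h; rfl

omit [IsTopologicalGroup G] in
/-- `evalOne` respects subtraction. [cite: NeukirchSchmidtWingberg2008, I.§6 Prop. (1.6.4)] -/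
theorem evalOne_sub (F F' : contOneCocycles (coindFin X N)) :
    evalOne X N (F - F') = evalOne X N F - evalOne X N F' := by
  apply Subtype.ext; ext h; rfl

/-- **`evalOne ∘ shapiroCocycle = id`** for representatives with `s(1·N) = 1`:
`F(h)(1·N) = s(1·N) • f(s(1·N)⁻¹ h s(h⁻¹ • 1·N)) = f(h)`. [cite: NeukirchSchmidtWingberg2008, I.§6 Prop. (1.6.4)] -/
theorem evalOne_shapiroCocycle (hN : IsOpen (N : Set G)) {s : G ⧸ N → G}
    (hs : ∀ x : G ⧸ N, (s x : G ⧸ N) = x) (hs1 : s ((1 : G) : G ⧸ N) = 1)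
    (f : contOneCocycles (subgroupRep X N)) :
    evalOne X N (shapiroCocycle X N hN hs f) = f := by
  apply Subtype.ext
  ext h
  rw [evalOne_apply, shapiroCocycle_apply]
  have hmem : (h : G)⁻¹ • ((1 : G) : G ⧸ N) = ((1 : G) : G ⧸ N) := inv_smul_mk_one_of_mem N h.2
  have harg : schreierElt N hs (h : G) ((h : G)⁻¹ • ((1 : G) : G ⧸ N)) = h := by
    apply Subtype.ext
    rw [schreierElt_coe, smul_inv_smul, hmem, hs1, inv_one, one_mul, mul_one]
  rw [harg, hs1, map_one]
  rfl

/-- **Evaluation at the unit coset of a coboundary is a coboundary**: if `[F] = 0` in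
`H¹(G, Maps(G ⧸ N, X))` then `[evalOne F] = 0` in `H¹(N, X)` (`F = ∂φ` gives
`F(h)(1·N) = h • φ(1·N) − φ(1·N)`). [cite: NeukirchSchmidtWingberg2008, I.§6 Prop. (1.6.4)] -/
theorem oneCocycleClass_evalOne_eq_zero (F : contOneCocycles (coindFin X N))
    (hF : oneCocycleClass (coindFin X N) F = 0) :
    oneCocycleClass (subgroupRep X N) (evalOne X N F) = 0 := by
  obtain ⟨φ, hφ⟩ := (oneCocycleClass_eq_zero_iff _ F).mp hF
  refine (oneCocycleClass_eq_zero_iff _ _).mpr ⟨φ ((1 : G) : G ⧸ N), fun h => ?_⟩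
  rw [evalOne_apply, hφ, coindFin_sub_apply, coindFin_ρ_apply, inv_smul_mk_one_of_mem N h.2,
    subgroupRep_ρ_apply]

/-- **Shapiro injectivity in degree one.** If the evaluation at the unit coset of a continuous
crossed homomorphism `F : G → Maps(G ⧸ N, X)` is a coboundary on `N`, `F(h)(1·N) = h • v − v`
(`h ∈ N`), then `F` is a coboundary: `F = ∂φ` with `φ(y) = s(y) • v − F(s(y))(y)` for any system of
representatives `s` (compare the cocycle identity at `g s(x) = s(g • x) · schreierElt g x`).
[cite: NeukirchSchmidtWingberg2008, I.§6 Prop. (1.6.4)] [cite: SerreLocalFields1979, VII.§6] -/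
theorem oneCocycleClass_eq_zero_of_evalOne {s : G ⧸ N → G} (hs : ∀ x : G ⧸ N, (s x : G ⧸ N) = x)
    (F : contOneCocycles (coindFin X N))
    (hF : oneCocycleClass (subgroupRep X N) (evalOne X N F) = 0) :
    oneCocycleClass (coindFin X N) F = 0 := by
  obtain ⟨v, hv⟩ := (oneCocycleClass_eq_zero_iff _ _).mp hF
  refine (oneCocycleClass_eq_zero_iff _ F).mpr ⟨fun y => X.ρ (s y) v - F.1 (s y) y, fun g => ?_⟩
  refine funext fun y => ?_
  -- write `y = g • x`
  obtain ⟨x, rfl⟩ : ∃ x, y = g • x := ⟨g⁻¹ • y, (smul_inv_smul g y).symm⟩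
  rw [coindFin_sub_apply, coindFin_ρ_apply, inv_smul_smul]
  -- the two factorizations `g · s(x) = s(g • x) · n`, `n = schreierElt g x ∈ N`
  set n : N := schreierElt N hs g x with hn
  have hprod : g * s x = s (g • x) * (n : G) := (rep_mul_schreierElt N hs g x).symm
  -- cocycle identity along `g · s(x)`, evaluated at `g • x`
  have h1 : F.1 (g * s x) (g • x) = F.1 g (g • x) + X.ρ g (F.1 (s x) x) := by
    rw [F.2, coindFin_add_apply, coindFin_ρ_apply, inv_smul_smul]
  -- cocycle identity along `s(g • x) · n`, evaluated at `g • x`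
  have hfix : (s (g • x))⁻¹ • (g • x) = ((1 : G) : G ⧸ N) := rep_inv_smul N hs (g • x)
  have hvn : F.1 (n : G) ((1 : G) : G ⧸ N) = X.ρ (n : G) v - v := by
    have := hv n
    rwa [evalOne_apply, subgroupRep_ρ_apply] at this
  have h2 : F.1 (s (g • x) * (n : G)) (g • x) =
      F.1 (s (g • x)) (g • x) + (X.ρ (g * s x) v - X.ρ (s (g • x)) v) := by
    rw [F.2, coindFin_add_apply, coindFin_ρ_apply, hfix, hvn, map_sub, ← ρ_mul_apply, ← hprod]
  have key : F.1 g (g • x) + X.ρ g (F.1 (s x) x) =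
      F.1 (s (g • x)) (g • x) + (X.ρ (g * s x) v - X.ρ (s (g • x)) v) := by
    rw [← h1, ← h2, hprod]
  rw [ρ_mul_apply] at key
  rw [map_sub, eq_sub_of_add_eq key]
  abel

end EvalOne

/-! ## Right translations (for `N` normal) and the action of `G ⧸ N` on `H¹(N, X)` -/

section RightTranslation

variable (X : TopRep.{v} R G) (N : Subgroup G) [N.Normal]

omit [TopologicalSpace G] [IsTopologicalGroup G] in
/-- In `G ⧸ N` (a group, `N` normal), the left action of `G` commutes with right multiplication:
`g • (y c) = (g • y) c`. [cite: NeukirchSchmidtWingberg2008, I.§5 (coset representatives)] -/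
theorem smul_mul_quotient (g : G) (y c : G ⧸ N) : g • (y * c) = (g • y) * c := by
  induction y using QuotientGroup.induction_on with
  | H a =>
    induction c using QuotientGroup.induction_on with
    | H b =>
      rw [← QuotientGroup.mk_mul, MulAction.Quotient.smul_coe, MulAction.Quotient.smul_coe,
        ← QuotientGroup.mk_mul, smul_eq_mul, smul_eq_mul, mul_assoc]

/-- Right translation by `c ∈ G ⧸ N` on functions `G ⧸ N → X`: `(R_c φ)(y) = φ(y c)`, a continuous
linear map. [cite: SerreLocalFields1979, VII.§5] -/
def rTransOp (c : G ⧸ N) : (G ⧸ N → X) →L[R] (G ⧸ N → X) where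
  toFun φ := fun y => φ (y * c)
  map_add' _ _ := rfl
  map_smul' _ _ := rfl
  cont := continuous_pi fun y => continuous_apply (y * c)

omit [TopologicalSpace G] [IsTopologicalGroup G] in
/-- Unfolding `rTransOp`. [cite: SerreLocalFields1979, VII.§5] -/
@[simp]
theorem rTransOp_apply (c : G ⧸ N) (φ : G ⧸ N → X) (y : G ⧸ N) :
    rTransOp X N c φ y = φ (y * c) :=
  rfl

/-- **Right translation is `G`-equivariant**: `R_c` is an endomorphism of the representation
`coindFin X N` (`g • (y c) = (g • y) c`). For `N` of finite index these endomorphisms realise the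
`ℤ[G/N]`-module structure of `Ind_N^G X ≅ X ⊗ ℤ[G/N]` on the second factor. [cite: SerreLocalFields1979, VII.§5–§6] -/
def rTransHom (c : G ⧸ N) : coindFin X N ⟶ coindFin X N :=
  TopRep.ofHom
    { toContinuousLinearMap := rTransOp X N c
      isIntertwining' := fun g => by
        ext φ y
        change (coindFin X N).ρ g φ (y * c) = X.ρ g (φ ((g⁻¹ • y) * c))
        rw [coindFin_ρ_apply, smul_mul_quotient] }

omit [TopologicalSpace G] [IsTopologicalGroup G] in
/-- Values of `rTransHom`. [cite: SerreLocalFields1979, VII.§5] -/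
@[simp]
theorem rTransHom_apply (c : G ⧸ N) (φ : coindFin X N) (y : G ⧸ N) :
    (rTransHom X N c).hom φ y = φ (y * c) :=
  rfl

variable {X N} in
/-- Post-composition of a continuous crossed homomorphism with an endomorphism of the
representation: `g ↦ η(F(g))` is again a crossed homomorphism. [cite: SerreLocalFields1979, VII.§5] -/
def postcomp {Y : TopRep.{v} R G} (η : Y ⟶ Y) (F : contOneCocycles Y) : contOneCocycles Y :=
  ⟨(η.hom : C(Y, Y)).comp F.1, fun g h => by
    change η.hom (F.1 (g * h)) = η.hom (F.1 g) + Y.ρ g (η.hom (F.1 h))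
    rw [F.2, map_add, TopRep.hom_comm_apply η g]⟩

omit [IsTopologicalGroup G] in
/-- Values of `postcomp`. [cite: SerreLocalFields1979, VII.§5] -/
@[simp]
theorem postcomp_apply {Y : TopRep.{v} R G} (η : Y ⟶ Y) (F : contOneCocycles Y) (g : G) :
    (postcomp η F).1 g = η.hom (F.1 g) :=
  rfl

/-- Post-composition with an endomorphism preserves coboundaries: `η(∂v) = ∂(η v)`. [cite: SerreLocalFields1979, VII.§5] -/
theorem oneCocycleClass_postcomp_eq_zero {Y : TopRep.{v} R G} (η : Y ⟶ Y) (F : contOneCocycles Y)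
    (hF : oneCocycleClass Y F = 0) : oneCocycleClass Y (postcomp η F) = 0 := by
  obtain ⟨v, hv⟩ := (oneCocycleClass_eq_zero_iff _ F).mp hF
  refine (oneCocycleClass_eq_zero_iff _ _).mpr ⟨η.hom v, fun g => ?_⟩
  rw [postcomp_apply, hv, map_sub, TopRep.hom_comm_apply η g]

/-- **Under `evalOne`, right translation by `γN` is the action of `γ` on `H¹(N, X)`**:
`γ · [h ↦ F(h)(N)] = [h ↦ F(h)(γN)]`.  On cocycles, `γ • F(γ⁻¹ h γ)(N) = F(h)(γN) + (h • t − t)`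
with `t = F(γ)(γN)` (cocycle identities at `γ⁻¹ · (h γ)` and `γ⁻¹ · γ = 1`).
[cite: SerreLocalFields1979, VII.§5] [cite: NeukirchSchmidtWingberg2008, I.§5–§6] -/
theorem conjMap_evalOne_eq (γ : G) (F : contOneCocycles (coindFin X N)) :
    conjMap X N γ 1 (oneCocycleClass _ (evalOne X N F)) =
      oneCocycleClass _ (evalOne X N (postcomp (rTransHom X N (γ : G ⧸ N)) F)) := by
  rw [conjMap_oneCocycleClass, ← sub_eq_zero, ← oneCocycleClass_sub, oneCocycleClass_eq_zero_iff]
  refine ⟨F.1 γ (γ : G ⧸ N), fun h => ?_⟩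
  rw [Submodule.coe_sub, ContinuousMap.sub_apply, conj_pullback_apply, evalOne_apply, evalOne_apply,
    postcomp_apply, rTransHom_apply, subgroupRep_ρ_apply, subgroupConj_apply_coe]
  -- `F(γ⁻¹ h γ) = F(γ⁻¹) + γ⁻¹ ⋆ (F(h) + h ⋆ F(γ))`
  have hmul : F.1 (γ⁻¹ * h * γ) =
      F.1 γ⁻¹ + (coindFin X N).ρ γ⁻¹ (F.1 h + (coindFin X N).ρ (h : G) (F.1 γ)) := by
    rw [mul_assoc, F.2, F.2]
  -- `F(γ⁻¹) = -(γ⁻¹ ⋆ F(γ))`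
  have hinv : F.1 γ⁻¹ = -((coindFin X N).ρ γ⁻¹ (F.1 γ)) := by
    have h0 := F.2 γ⁻¹ γ
    rw [inv_mul_cancel, contOneCocycles.apply_one] at h0
    exact eq_neg_of_add_eq_zero_left h0.symm
  have hone : ((1 : G) : G ⧸ N) * (γ : G ⧸ N) = (γ : G ⧸ N) := by
    rw [← QuotientGroup.mk_mul, one_mul]
  have hγ1 : γ • ((1 : G) : G ⧸ N) = (γ : G ⧸ N) := by
    rw [MulAction.Quotient.smul_coe, smul_eq_mul, mul_one]
  have hfix : (h : G)⁻¹ • (γ : G ⧸ N) = (γ : G ⧸ N) := by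
    rw [MulAction.Quotient.smul_coe, smul_eq_mul, QuotientGroup.eq, mul_inv_rev, inv_inv]
    exact Subgroup.Normal.conj_mem' inferInstance _ h.2 γ
  rw [hmul, hinv, hone]
  simp only [coindFin_add_apply, coindFin_neg_apply, coindFin_ρ_apply, inv_inv, map_add, map_neg,
    ρ_apply_ρ_inv_apply, hγ1, hfix]
  abel

end RightTranslation

end Literature.NumberTheory.GaloisRepresentations

end
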